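import Literature.Analysis.FluidPDE.PineauVicolBernoulli
import Literature.Analysis.FluidPDE.LerayProfileCalculus
import Literature.Analysis.FluidPDE.TsaiProfileEndgame
import HarnessLib

/-!
# Crux `Target` ≡ `TypeICertificateLadder.NoTypeIBlowup` (stmt-NavierStokesRegularity-1217),
  line `killing-twisted-bernoulli-solitons`: STUB B1, the Killing-twisted head identity

For a smooth solution `(U, P)` of Pineau–Vicol's rotated self-similar profile system
(arXiv:2607.09619, (1.8a)): `α(JU − (Jy·∇)U) + ½U + ½(y·∇)U − ΔU + (U·∇)U + ∇P = 0`,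
`∇·U = 0`, `J = rotGen` (`J v = (−v₁, v₀, 0) = e₃ × v`), the head pressure ("Bernoulli
function", (4.1)) `Π = ½|U|² + P + ½ y·U = headPressure ½ U P` twisted by the Killing density
`Γ = ⟪Jy, U⟫` (the swirl, `swirl U`), `Π_α = Π − αΓ`, satisfies, with the ROTATING drift
`b_α = U + ½y − αJy`, the pointwise identity

  `−ΔΠ_α + DΠ_α[b_α] = −|curl U|² + 2α (curl U)₂`,   `(curl U)₂ = ∂₀U₁ − ∂₁U₀`

(`stub_twistedHeadIdentity`). At `α = 0` this is Tsai's (1.7) / Pineau–Vicol's (4.3); for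
`α ≠ 0` the error term `αE` of (4.3)–(4.4) is absorbed EXACTLY by the twist and the rotation of
the drift, leaving the signed vorticity component `2αΩ₃`.

Proof. (i) The pressure Poisson equation `ΔP = −tr((∇U)²)` is DERIVED from the system by taking
its divergence (`twistedHead_laplacian_pressure`): `div ΔU = 0`, `div U = 0`,
`div((y·∇)U) = 0`, `div((U·∇)U) = tr((∇U)²)` (tree: `LerayProfileCalculus`,
`PressurePoisson`) and `div(JU − (Jy·∇)U) = tr(J∘DU) − tr(DU∘J) − (Jy)·∇(div U) = 0`
(`twistedHead_divergence_rotForcing_eq_zero`, trace cyclicity and Schwarz); in coordinates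
(`twistedHead_sum_pderiv_pderiv_pressure`) this is the hypothesis `hΔP` of the tree's Bernoulli
identity `PineauVicol2026.bernoulli_identity_rdss` ((4.3): `−ΔΠ + DΠ[U + ½y] = −|Ω|² + αE`,
`E = ½⟪Jy, U⟫ + ⟪U + ½y, DU(Jy)⟫`). (ii) `DΠ[Jy] = E + DP[Jy]` (`fderiv_headPressure_apply`);
`ΔΓ = ⟪Jy, ΔU⟫ + 2Ω₃` and `DΓ[w] = ⟪Jy, DU w⟫ + ⟪Jw, U⟫` (`laplacian_swirl`,
`fderiv_swirl_apply`); the system dotted with `Jy` gives `⟪Jy, ΔU⟫`, and the skewness of `J`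
(`⟪JU, U⟫ = 0`, `⟪JJy, U⟫ = −⟪Jy, JU⟫`) closes the bookkeeping:
`L_αΠ_α = (−|Ω|² + αE) − α(E + DP[Jy]) + α(DP[Jy] + 2Ω₃) = −|Ω|² + 2αΩ₃`.

Lands `--supports stmt-NavierStokesRegularity-1217` (consumed verbatim by stub B3,
`stub_solitonLaws`, of the same line).

## References

* B. Pineau, V. Vicol, arXiv:2607.09619 (2026): (1.8a) p. 3, proof of Lemma 2.1 p. 9
  ("`∇·(JU − (Jy·∇)U) = 0` … when `∇·U = 0`"), §4 (4.1)–(4.6) pp. 11–12. [PineauVicol2026]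
* T.-P. Tsai, ARMA 143 (1998), (1.7), (2.1) (the case `α = 0`). [Tsai1998]
-/

noncomputable section

namespace Summit.NavierStokesRegularity.NavierStokesRegularity.Theorems

open Set Function InnerProductSpace
open scoped BigOperators RealInnerProductSpace Laplacian ContDiff
open Literature.Analysis.FluidPDE

/-! ### The pressure Poisson equation of the rotated profile system -/

/-- **The rotation forcing is divergence free** (Pineau–Vicol 2026, proof of Lemma 2.1, p. 9:
"`∇·(JU − (Jy·∇)U) = 0` … when `∇·U = 0`"): for a divergence-free `C²` field `U` on `ℝ³`,
`div (y ↦ J U(y) − DU(y)(Jy)) = tr(J ∘ DU) − tr(DU ∘ J) − (Jy)·∇(div U) = 0`.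
[cite: PineauVicol2026, proof of Lemma 2.1 (p. 9)] -/
theorem twistedHead_divergence_rotForcing_eq_zero
    {U : EuclideanSpace ℝ (Fin 3) → EuclideanSpace ℝ (Fin 3)} (hU : ContDiff ℝ 2 U)
    (hdiv : VectorCalculus.IsDivFree U) (y : EuclideanSpace ℝ (Fin 3)) :
    VectorCalculus.divergence (fun x => rotGen (U x) - fderiv ℝ U x (rotGen x)) y = 0 := by
  have hUd : Differentiable ℝ U := hU.differentiable two_ne_zero
  have hDUd : Differentiable ℝ (fderiv ℝ U) :=
    (hU.fderiv_right (m := 1) le_rfl).differentiable one_ne_zero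
  have hJ : ∀ x : EuclideanSpace ℝ (Fin 3), HasFDerivAt rotGen rotGenL x := hasFDerivAt_rotGen
  have h1 : DifferentiableAt ℝ (fun x => rotGen (U x)) y :=
    (hJ (U y)).differentiableAt.comp y (hUd y)
  have h2 : DifferentiableAt ℝ (fun x => fderiv ℝ U x (rotGen x)) y :=
    (hDUd y).clm_apply (hJ y).differentiableAt
  have hc : HasFDerivAt (fun x => rotGen (U x)) (rotGenL.comp (fderiv ℝ U y)) y :=
    (hJ (U y)).comp y (hUd y).hasFDerivAt
  rw [divergence_sub_apply h1 h2, divergence_eq_traceCLM, divergence_eq_traceCLM, hc.fderiv,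
    fderiv_clm_apply (hDUd y) (hJ y).differentiableAt, (hJ y).fderiv, map_add]
  -- `tr (D²U(y)(·, Jy)) = D(div U)(y)[Jy] = 0` (Schwarz)
  have hsymm : traceCLM ((fderiv ℝ (fderiv ℝ U) y).flip (rotGen y)) =
      fderiv ℝ (VectorCalculus.divergence U) y (rotGen y) := by
    rw [fderiv_divergence_apply hU]
    congr 1
    refine ContinuousLinearMap.ext fun u => ?_
    simp only [ContinuousLinearMap.flip_apply]
    exact (hU.contDiffAt.isSymmSndFDerivAt (n := 2) (by simp)) u (rotGen y)
  have hdiv0 : VectorCalculus.divergence U = fun _ => (0 : ℝ) := funext hdiv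
  -- `tr (J ∘ DU) = tr (DU ∘ J)`
  rw [hsymm, hdiv0, fderiv_fun_const, Pi.zero_apply, zero_apply, add_zero,
    traceCLM_apply, traceCLM_apply, ContinuousLinearMap.toLinearMap_comp,
    ContinuousLinearMap.toLinearMap_comp, LinearMap.trace_comp_comm', sub_self]

/-- **Pressure Poisson equation of the rotated profile system, trace form**: if `U ∈ C³`,
`P ∈ C²`, `∇·U = 0` and `α(JU − (Jy·∇)U) + ½U + ½(y·∇)U − ΔU + (U·∇)U + ∇P = 0` pointwise
(Pineau–Vicol (1.8a)), then `ΔP = −tr(DU ∘ DU)` — the divergence of the system, using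
`div ΔU = 0`, `div U = 0`, `div((y·∇)U) = 0`, `div((U·∇)U) = tr((DU)²)` and
`div(JU − (Jy·∇)U) = 0` (this is the local form of `P = RᵢRⱼ(UᵢUⱼ)`, Lemma 2.1 (2.3)).
[cite: PineauVicol2026, Lemma 2.1 and its proof (p. 9)] -/
theorem twistedHead_laplacian_pressure
    {U : EuclideanSpace ℝ (Fin 3) → EuclideanSpace ℝ (Fin 3)} {P : EuclideanSpace ℝ (Fin 3) → ℝ}
    {α : ℝ} (hU3 : ContDiff ℝ 3 U) (hP2 : ContDiff ℝ 2 P) (hdiv : VectorCalculus.IsDivFree U)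
    (heq : ∀ y, α • (rotGen (U y) - fderiv ℝ U y (rotGen y)) + (1 / 2 : ℝ) • U y +
      (1 / 2 : ℝ) • fderiv ℝ U y y - (Δ U) y + fderiv ℝ U y (U y) + gradient P y = 0)
    (y : EuclideanSpace ℝ (Fin 3)) :
    (Δ P) y = -traceCLM ((fderiv ℝ U y).comp (fderiv ℝ U y)) := by
  have hU2 : ContDiff ℝ 2 U := hU3.of_le (by norm_num)
  have hU1 : ContDiff ℝ 1 U := hU3.of_le (by norm_num)
  have hUd : Differentiable ℝ U := hU1.differentiable one_ne_zero
  have hDUd : Differentiable ℝ (fderiv ℝ U) :=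
    (hU2.fderiv_right (m := 1) le_rfl).differentiable one_ne_zero
  -- `∇P` solved from the system
  have hgradP : gradient P = fun x => (Δ U) x - α • (rotGen (U x) - fderiv ℝ U x (rotGen x)) -
      (1 / 2 : ℝ) • U x - (1 / 2 : ℝ) • fderiv ℝ U x x - convect U U x := by
    funext x
    have hx := heq x
    rw [← sub_eq_zero, ← hx, convect_apply]
    abel
  rw [← divergence_gradient hP2 y, hgradP]
  have hJ : ∀ x : EuclideanSpace ℝ (Fin 3), HasFDerivAt rotGen rotGenL x := hasFDerivAt_rotGen
  have hdA : DifferentiableAt ℝ (Δ U) y := (differentiable_laplacian hU3) y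
  have hdF : DifferentiableAt ℝ (fun x => rotGen (U x) - fderiv ℝ U x (rotGen x)) y :=
    ((hJ (U y)).differentiableAt.comp y (hUd y)).sub ((hDUd y).clm_apply (hJ y).differentiableAt)
  have hdF' : DifferentiableAt ℝ (fun x => α • (rotGen (U x) - fderiv ℝ U x (rotGen x))) y :=
    hdF.const_smul α
  have hdB : DifferentiableAt ℝ (fun x => (1 / 2 : ℝ) • U x) y := (hUd y).const_smul (1 / 2 : ℝ)
  have hdC : DifferentiableAt ℝ (fun x => fderiv ℝ U x x) y :=
    (hDUd y).clm_apply differentiableAt_fun_id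
  have hdC' : DifferentiableAt ℝ (fun x => (1 / 2 : ℝ) • fderiv ℝ U x x) y :=
    hdC.const_smul (1 / 2 : ℝ)
  have hdD : DifferentiableAt ℝ (convect U U) y := (hDUd y).clm_apply (hUd y)
  have hd1 : DifferentiableAt ℝ
      (fun x => (Δ U) x - α • (rotGen (U x) - fderiv ℝ U x (rotGen x))) y := hdA.sub hdF'
  have hd2 : DifferentiableAt ℝ (fun x => (Δ U) x - α • (rotGen (U x) - fderiv ℝ U x (rotGen x)) -
      (1 / 2 : ℝ) • U x) y := hd1.sub hdB
  have hd3 : DifferentiableAt ℝ (fun x => (Δ U) x - α • (rotGen (U x) - fderiv ℝ U x (rotGen x)) -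
      (1 / 2 : ℝ) • U x - (1 / 2 : ℝ) • fderiv ℝ U x x) y := hd2.sub hdC'
  rw [divergence_sub_apply hd3 hdD, divergence_sub_apply hd2 hdC', divergence_sub_apply hd1 hdB,
    divergence_sub_apply hdA hdF', divergence_const_smul_apply hdF,
    divergence_const_smul_apply (hUd y), divergence_const_smul_apply hdC,
    divergence_laplacian_eq_zero hU3 hdiv, hdiv y, divergence_fderiv_apply_self_eq_zero hU2 hdiv,
    divergence_convect_self_eq hU2 hdiv, twistedHead_divergence_rotForcing_eq_zero hU2 hdiv]
  ring

/-- **Pressure Poisson equation of the rotated profile system, in coordinates**: under the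
hypotheses of `twistedHead_laplacian_pressure`, `∑ₗ ∂ₗ∂ₗP = −∑ₗⱼ ∂ₗUⱼ ∂ⱼUₗ` — the form of the
hypothesis `hΔP` of `PineauVicol2026.bernoulli_identity_rdss` / `driftOp_headPressure_forced`.
[cite: PineauVicol2026, Lemma 2.1 and its proof (p. 9)] -/
theorem twistedHead_sum_pderiv_pderiv_pressure
    {U : EuclideanSpace ℝ (Fin 3) → EuclideanSpace ℝ (Fin 3)} {P : EuclideanSpace ℝ (Fin 3) → ℝ}
    {α : ℝ} (hU3 : ContDiff ℝ 3 U) (hP2 : ContDiff ℝ 2 P) (hdiv : VectorCalculus.IsDivFree U)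
    (heq : ∀ y, α • (rotGen (U y) - fderiv ℝ U y (rotGen y)) + (1 / 2 : ℝ) • U y +
      (1 / 2 : ℝ) • fderiv ℝ U y y - (Δ U) y + fderiv ℝ U y (U y) + gradient P y = 0)
    (y : EuclideanSpace ℝ (Fin 3)) :
    ∑ l, pderiv l (pderiv l P) y =
      -∑ l, ∑ j, pderiv l (fun z => U z j) y * pderiv j (fun z => U z l) y := by
  have hUd : DifferentiableAt ℝ U y := (hU3.differentiable (by norm_num)) y
  have hD : ∀ j i : Fin 3, fderiv ℝ U y (EuclideanSpace.single j 1) i =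
      pderiv j (fun z => U z i) y := fun j i => by
    rw [pderiv_apply, euclidean_fderiv_apply_comp hUd]
  rw [← laplacian_eq_sum_pderiv_pderiv' hP2 y, twistedHead_laplacian_pressure hU3 hP2 hdiv heq y,
    traceCLM_comp_self_eq_sum_sum (EuclideanSpace.basisFun (Fin 3) ℝ)]
  congr 1
  refine Finset.sum_congr rfl fun l _ => Finset.sum_congr rfl fun j _ => ?_
  simp only [EuclideanSpace.basisFun_apply, EuclideanSpace.inner_single_left, map_one, one_mul, hD]
  ring

/-! ### Stub B1: the Killing-twisted head identity -/

/-- **Stub B1 — the Killing-twisted head identity.** Let `U`, `P` be smooth on `ℝ³` with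
`∇·U = 0`, solving the rotated self-similar profile system (Pineau–Vicol (1.8a))
`α(JU − DU(Jy)) + ½U + ½DU(y) − ΔU + DU(U) + ∇P = 0`, `J = rotGen`. Then the twisted head
`Π_α(z) = headPressure ½ U P z − α⟪Jz, U z⟫` (`= ½|U|² + P + ½⟪z, U⟫ − α⟪Jz, U⟫`) obeys,
for every `y`,
`−ΔΠ_α(y) + DΠ_α(y)[U(y) + ½y − αJy] = −‖curl U(y)‖² + 2α (curl U(y))₂`,
`(curl U)₂ = ∂₀U₁ − ∂₁U₀`. The case `α = 0` is Tsai's (1.7) = Pineau–Vicol's (4.3); for general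
`α` the proof is `bernoulli_identity_rdss` ((4.3) with its error term `αE`, (4.4)), the pressure
Poisson equation derived from the system (`twistedHead_sum_pderiv_pderiv_pressure`), the swirl
calculus `ΔΓ = ⟪Jy, ΔU⟫ + 2Ω₃`, `DΓ[w] = ⟪Jy, DU w⟫ + ⟪Jw, U⟫` (`laplacian_swirl`,
`fderiv_swirl_apply`), the system dotted with `Jy`, and the skewness of `J`.
[cite: PineauVicol2026, (4.3)–(4.6) (pp. 11–12)] -/
theorem stub_twistedHeadIdentity :
    ∀ (α : ℝ) (U : EuclideanSpace ℝ (Fin 3) → EuclideanSpace ℝ (Fin 3)) (P : EuclideanSpace ℝ (Fin 3) → ℝ), ContDiff ℝ (⊤ : ℕ∞) U → ContDiff ℝ (⊤ : ℕ∞) P → Literature.Analysis.FluidPDE.VectorCalculus.IsDivFree U → (∀ y : EuclideanSpace ℝ (Fin 3), α • (Literature.Analysis.FluidPDE.rotGen (U y) - fderiv ℝ U y (Literature.Analysis.FluidPDE.rotGen y)) + (1 / 2 : ℝ) • U y + (1 / 2 : ℝ) • fderiv ℝ U y y - Laplacian.laplacian U y + fderiv ℝ U y (U y) + gradient P y = 0)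 → ∀ y : EuclideanSpace ℝ (Fin 3), -(Laplacian.laplacian (fun z => Literature.Analysis.FluidPDE.headPressure (1 / 2) U P z - α * inner ℝ (Literature.Analysis.FluidPDE.rotGen z) (U z)) y) + fderiv ℝ (fun z => Literature.Analysis.FluidPDE.headPressure (1 / 2) U P z - α * inner ℝ (Literature.Analysis.FluidPDE.rotGen z) (U z)) y (U y + (1 / 2 : ℝ) • y - α • Literature.Analysis.FluidPDE.rotGen y) = -‖Literature.Analysis.FluidPDE.curl U y‖ ^ 2 + 2 * α * (Literature.Analysis.FluidPDE.curl U y) 2 := by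
  intro α U P hU hP hdiv heq y
  have hU2 : ContDiff ℝ 2 U := hU.of_le (WithTop.coe_le_coe.2 le_top)
  have hU3 : ContDiff ℝ 3 U := hU.of_le (WithTop.coe_le_coe.2 le_top)
  have hP2 : ContDiff ℝ 2 P := hP.of_le (WithTop.coe_le_coe.2 le_top)
  have hUd : Differentiable ℝ U := hU.differentiable (by simp)
  have hPd : Differentiable ℝ P := hP.differentiable (by simp)
  -- the twisted head is `Π − α • Γ`, `Γ = swirl U = ⟪J·, U·⟫`
  have hfun : (fun z => headPressure (1 / 2) U P z - α * ⟪rotGen z, U z⟫) =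
      headPressure (1 / 2) U P - α • swirl U := by
    funext z
    simp only [Pi.sub_apply, Pi.smul_apply, smul_eq_mul, swirl_eq_inner_rotGen]
  have hHc : ContDiff ℝ 2 (headPressure (1 / 2) U P) :=
    Literature.Analysis.FluidPDE.contDiff_headPressure hU2 hP2
  have hSc : ContDiff ℝ 2 (swirl U) := contDiff_swirl hU2
  have hαSc : ContDiff ℝ 2 (α • swirl U) := contDiff_const.smul hSc
  have hHd : Differentiable ℝ (headPressure (1 / 2) U P) := hHc.differentiable two_ne_zero
  have hSd : Differentiable ℝ (swirl U) := hSc.differentiable two_ne_zero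
  have hαSd : Differentiable ℝ (α • swirl U) := hαSc.differentiable two_ne_zero
  have hLap : (Δ (fun z => headPressure (1 / 2) U P z - α * ⟪rotGen z, U z⟫)) y =
      (Δ (headPressure (1 / 2) U P)) y - α * (Δ (swirl U)) y := by
    rw [hfun, hHc.contDiffAt.laplacian_sub hαSc.contDiffAt, laplacian_smul α hSc.contDiffAt,
      smul_eq_mul]
  have hDer : fderiv ℝ (fun z => headPressure (1 / 2) U P z - α * ⟪rotGen z, U z⟫) y =
      fderiv ℝ (headPressure (1 / 2) U P) y - α • fderiv ℝ (swirl U) y := by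
    rw [hfun, fderiv_sub (hHd y) (hαSd y), fderiv_const_smul (hSd y)]
  -- the pressure Poisson equation, derived from the system
  have hΔP : ∀ z : EuclideanSpace ℝ (Fin 3), ∑ l, pderiv l (pderiv l P) z =
      -∑ l, ∑ j, pderiv l (fun x => U x j) z * pderiv j (fun x => U x l) z :=
    twistedHead_sum_pderiv_pderiv_pressure hU3 hP2 hdiv heq
  -- (4.3): `−(ΔΠ − DΠ[U + ½y]) + ‖curl U‖² = αE`
  have heq0 : ∀ z, (0 : EuclideanSpace ℝ (Fin 3)) + α • (rotGen (U z) - fderiv ℝ U z (rotGen z)) +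
      (1 / 2 : ℝ) • U z + (1 / 2 : ℝ) • fderiv ℝ U z z - (Δ U) z + convect U U z + gradient P z =
      0 := fun z => by rw [zero_add]; exact heq z
  have hB := PineauVicol2026.bernoulli_identity_rdss (Us := fun _ => 0) hU hP heq0 hdiv hΔP y
  simp only [inner_zero_right, sub_zero, driftOp, one_mul, inner_add_left,
    real_inner_smul_left] at hB
  -- `DΠ[Jy] = E + DP[Jy]`
  have hDHJ := fderiv_headPressure_apply (a := 1 / 2) hUd hPd y (rotGen y)
  -- `DΓ[b_α]`, `ΔΓ = ⟪Jy, ΔU⟫ + 2Ω₃`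
  have hDS := fderiv_swirl_apply (hUd y) (U y + (1 / 2 : ℝ) • y - α • rotGen y)
  have hΔS := laplacian_swirl hU2 y
  have hΩ : curl U y 2 = fderiv ℝ U y (EuclideanSpace.single 0 1) 1 -
      fderiv ℝ U y (EuclideanSpace.single 1 1) 0 := by
    simp [curl]
  -- the system dotted with `Jy`
  have hEJ : ⟪rotGen y, α • (rotGen (U y) - fderiv ℝ U y (rotGen y)) + (1 / 2 : ℝ) • U y +
      (1 / 2 : ℝ) • fderiv ℝ U y y - Δ U y + fderiv ℝ U y (U y) + gradient P y⟫ = 0 := by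
    rw [heq y, inner_zero_right]
  simp only [inner_add_right, inner_sub_right, real_inner_smul_right, inner_gradient_right,
    RCLike.conj_to_real] at hEJ
  -- skewness of `J`: `⟪JU, U⟫ = 0`, `⟪JJy, U⟫ = −⟪Jy, JU⟫`; linearity of `J`
  have hJU : ⟪rotGen (U y), U y⟫ = 0 := inner_rotGen_self (U y)
  have hJJ : ⟪rotGen (rotGen y), U y⟫ + ⟪rotGen y, rotGen (U y)⟫ = 0 := by
    rw [inner_rotGen_left, inner_rotGen_left]
    simp only [rotGen_apply_zero, rotGen_apply_one]
    ring
  have hJb : rotGen (U y + (1 / 2 : ℝ) • y - α • rotGen y) =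
      rotGen (U y) + (1 / 2 : ℝ) • rotGen y - α • rotGen (rotGen y) := by
    rw [← rotGenL_apply, map_sub, map_add, map_smul, map_smul]
    rfl
  -- bookkeeping
  rw [hLap, hDer, sub_apply, smul_apply, hDS, hJb, hΔS, hΩ]
  simp only [map_add, map_sub, map_smul, smul_eq_mul, inner_add_right, inner_sub_right,
    real_inner_smul_right, inner_add_left, inner_sub_left, real_inner_smul_left, hDHJ] at hB ⊢
  linear_combination hB - α * hEJ + α ^ 2 * hJJ - α * hJU

end Summit.NavierStokesRegularity.NavierStokesRegularity.Theorems

end
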